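import Summits.CriticalPhenomena.PercolationContinuityZ3.Theorems.PercNearOneGluingAdditiveGluingFingersTwoRelaysAG
import Summits.CriticalPhenomena.PercolationContinuityZ3.Theorems.PercNearOneGluingAdditiveGluingFingerTwoTouchedB
import HarnessLib

/-! # Crux `PercNearOneGluing.AdditiveGluing` (stmt-CriticalPhenomena-4576) — `AdditiveGluing` for finger observers whose fingers touch at most
# two relays (one of which may be the target), every `A` (seat (b) V⁺-form, depth prover `png-dp-vplus`)

Support file (`--supports stmt-CriticalPhenomena-4576`); no definitions, no named facts.

`additiveGluing_fingers_twoRelays_withB` — **Theorem.**  Let `o ∉ A ∋ b`; suppose every non-relay vertex `x ≠ o` with `w(o,x) > 0` is a finger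
(positive-weight pairs only to `o` and to relays) and all these fingers together touch at most two relays `w₁, w₂` (either may be `b`).  Then for
every `t ≥ 0` with `μ_w(a↔b) ≥ 1 − t` on `A`: `μ_w(o ↔ A) − t ≤ μ_w(o ↔ b)`.  Summary of the finger class settled by this seat: `AdditiveGluing`
holds for finger observers whenever `|A| ≤ 3` (`additiveGluing_fingers_card_le_three`), or `|A| ≤ 4` and no finger touches `b`
(`additiveGluing_fingers_card_le_four_noB`), or the fingers touch at most two relays (this file) — any number of fingers.
[cite: KozmaNitzan2024, Thms 4–5 (pp. 12–14), Lemma 3 (pp. 6–7), §4 p. 20, Question 7 and Question 9 (p. 36)]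
-/

namespace Summit.CriticalPhenomena.PercolationContinuityZ3.Theorems

open MeasureTheory Set
open Literature.Probability.LatticeModels (prodBernoulli)
open Literature.Probability.Percolation (BondConfig openConn openGraph)
open scoped BigOperators Classical

noncomputable section

section FingersTwoRelaysB

open Literature.Probability.Percolation

variable {n : ℕ}

/-- **`AdditiveGluing` for finger observers whose fingers touch at most two relays (one may be `b`), every `A`.**
(`additiveGluing_fingers_of_FML3_gen` + `fingerML3_twoTouched_withB`.) [cite: KozmaNitzan2024, Thms 4–5 (pp. 12–14), Question 7 (p. 36)] -/
theorem additiveGluing_fingers_twoRelays_withB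
    (w : Sym2 (Fin n) → unitInterval) (A : Finset (Fin n)) (o b w₁ w₂ : Fin n) (hb : b ∈ A) (ho : o ∉ A)
    (hfing : ∀ x : Fin n, x ∉ A → x ≠ o → (w s(o, x) : ℝ) ≠ 0 →
      ∀ y : Fin n, y ∉ A → y ≠ o → y ≠ x → (w s(x, y) : ℝ) = 0)
    (htwo : ∀ x : Fin n, x ∉ A → x ≠ o → (w s(o, x) : ℝ) ≠ 0 →
      ∀ a ∈ A, a ≠ w₁ → a ≠ w₂ → (w s(x, a) : ℝ) = 0) :
    ∀ t : ℝ, 0 ≤ t →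
      (∀ a ∈ A, 1 - t ≤ (prodBernoulli w).real (openConn a b)) →
      (prodBernoulli w).real (⋃ a ∈ A, openConn o a) - t ≤ (prodBernoulli w).real (openConn o b) := by
  refine additiveGluing_fingers_of_FML3_gen w A o b hb ho ?_ hfing
  intro K N d hNA _ hd hfin hKw hfree hle
  have hvA : ∀ v ∈ N, v ∉ A := fun v hv => Finset.disjoint_left.1 hNA hv
  have htwoK : ∀ v ∈ N, ∀ a ∈ A, a ≠ w₁ → a ≠ w₂ → (K s(v, a) : ℝ) = 0 := by
    intro v hv a ha h1 h2
    have hao : a ≠ o := fun h => ho (h ▸ ha)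
    rw [hKw v a (hfin v hv).1 hao]
    exact htwo v (hvA v hv) (hfin v hv).1 (hfin v hv).2 a ha h1 h2
  have hintK : ∀ v ∈ N, ∀ v' ∈ N, v ≠ v' → (K s(v, v') : ℝ) = 0 := by
    intro v hv v' hv' hne
    rw [hKw v v' (hfin v hv).1 (hfin v' hv').1]
    exact hfing v (hvA v hv) (hfin v hv).1 (hfin v hv).2 v' (hvA v' hv') (hfin v' hv').1 (Ne.symm hne)
  exact fingerML3_twoTouched_withB K A N d b w₁ w₂ hb hNA hd hfree hle htwoK hintK

end FingersTwoRelaysB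

end

end Summit.CriticalPhenomena.PercolationContinuityZ3.Theorems
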